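import Summits.ResolutionOfSingularities.ResolutionOfSingularities.Theorems.FrobeniusLadderFInjectiveMacaulayficationGDDOfIsolatedDimThree
import Literature.AlgebraicGeometry.Resolution.ExcellentRingsFieldProofs
import Literature.AlgebraicGeometry.Resolution.QuasiExcellentLocalization
import Literature.AlgebraicGeometry.Resolution.GeneralLU
import Literature.AlgebraicGeometry.Resolution.GeneralLUProofs
import Literature.AlgebraicGeometry.Resolution.AlterationsBoundaryDivisor
import Literature.AlgebraicGeometry.Resolution.GenericPointStalkData
import Literature.AlgebraicGeometry.Resolution.StrictNormalCrossingsPoints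
import Literature.AlgebraicGeometry.Resolution.RegularLocalRingsQuotient
import Mathlib.RingTheory.DedekindDomain.Dvr
import Mathlib.RingTheory.DiscreteValuationRing.Basic
import Mathlib.RingTheory.Localization.LocalizationLocalization
import Mathlib.RingTheory.KrullDimension.Field
import HarnessLib

/-!
# ThmD-≤3 dispatcher: GDD at an isolated normal singular point of local dimension ≤ 3 of a finite-type scheme over a field
# (crux `FInjectiveMacaulayfication` stmt-ResolutionOfSingularities-15315, chain w45a; task (C′), RULING R16.4 (4))

[OURS · L1 W4.5a · res-L1-w45a-lead-1] Helper theorems toward the residual-class census (ThmD-≤3 = plan-1's named target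
`gdd_of_isolated_dim_le_three`, R15.25 (2)(4)); NOT door rungs, NOT statements of any manuscript; AI-written, weaker than expert review.
KNOWN dispatch/junk bookkeeping modulo two hypotheses BY TEXT — COR D1 `hD` (THEOREM-D, idea-1's `gdd_of_sncBlowupModel`) and the
surface case `h2` (idea-1's `gdd_of_normalSurfacePoint` modulo Lipman) — and the four printed threefold facts BY NAME.

* `gdd_of_radical_bot` — JUNK BRANCH `d = 0`: an Artinian local ring (`√0 = 𝔪`) has GDD via the ZERO filtration `I₀ = R`, `I_n = 0`
  (`n ≥ 1`): the punctured cone is EMPTY — the documented junk reading of `GDD` (res-L1-w45a-tri-2 REFEREE 2026-08-27T18:47:17Z).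
* `gdd_of_dim_one_of (hD)` — BRANCH `d = 1`: a normal Noetherian local domain of dimension `1` is a DVR (Dedekind + local), hence regular;
  `{𝔪} ⊆ Spec A` is a strict normal crossings divisor (`𝔪 = (ϖ)`), its ideal sheaf is effective Cartier, the identity is its blowing up
  (`IsBlowup.id`), and COR D1 `hD` applies verbatim — no `gr` computation.
* `gdd_of_isolated_dim_le_three_of (hD) (h2) (hG) (h081R) (hP) (hCJS)` — the DISPATCHER with the binders of idea-1's ThmDSig r16
  `gdd_of_isolated_dim_le_three` (minus `hL`, which only feeds `h2`): `S` a finite-type domain over a field `k` of characteristic `p`, `𝔭`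
  maximal, `S_𝔭` normal of dimension `≤ 3`, `S_𝔮` regular for every prime `𝔮 < 𝔭` ⇒ `GDD p S_𝔭`.  Cases on `dim S_𝔭 ∈ {0,1,2,3}`:
  `0` ⇒ `S_𝔭` is a field ⇒ `gdd_of_radical_bot`; `1` ⇒ `gdd_of_dim_one_of hD`; `2` ⇒ `h2`; `3` ⇒ (C) STEP 1
  `GDDOfIsolatedDimThree.gdd_of_isolatedSingularity_dimThree_of hD hG h081R hP hCJS` (p562898) after the TRANSPORT `S_𝔭 ↦ A`:
  `Spec S_𝔭` is quasi-excellent (Stacks 07QW for `S`, 07QU for the localisation and for `𝟙 (Spec S_𝔭)`, all PROVED in the tree), and a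
  non-maximal prime `𝔔` of `S_𝔭` contracts to `𝔮 < 𝔭` with `(S_𝔭)_𝔔 ≅ S_𝔮` (`IsLocalization.localizationLocalizationAtPrimeIsoLocalization`).
-/

-- single-problem summit: the doubled namespace component is forced
set_option linter.dupNamespace false
set_option autoImplicit false

noncomputable section

open CategoryTheory CategoryTheory.Limits AlgebraicGeometry TopologicalSpace IsLocalRing
open Literature.AlgebraicGeometry.Resolution Literature.AlgebraicGeometry.CossartPiltant200819
open Scheme.IdealSheafData

namespace Summit.ResolutionOfSingularities.ResolutionOfSingularities.Theorems.FInjectiveMacaulayfication.GDDOfIsolatedDimLeThree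

open Summit.ResolutionOfSingularities.ResolutionOfSingularities.Theorems.FInjectiveMacaulayfication
open Summit.ResolutionOfSingularities.ResolutionOfSingularities.Theorems.FInjectiveMacaulayfication.GDD

/-! ## §0 The junk branch `d = 0`: Artinian local rings -/

/-- **GDD for an Artinian local ring via the zero filtration.**  If `√0 = 𝔪` in the local ring `R` (i.e. `R` is Artinian local; e.g. a
field), then `GDD p R`: take `I₀ = R`, `I_n = 0` for `n ≥ 1`; the radical and Veronese conditions are immediate and the punctured cone is
empty (every localisation `G[1/(ā·Tᴺ)]`, `a ∈ I_N = 0`, is the zero ring, which has no maximal ideal).  [OURS · the documented junk reading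
of `GDD`; folklore] -/
theorem gdd_of_radical_bot (p : ℕ) (R : Type) [CommRing R] [IsLocalRing R]
    (h : (⊥ : Ideal R).radical = maximalIdeal R) : GDD p R := by
  classical
  let F : MultFiltration R :=
    { I := fun n => if n = 0 then ⊤ else ⊥
      I_zero := if_pos rfl
      antitone := by
        intro m n hmn
        show (if n = 0 then (⊤ : Ideal R) else ⊥) ≤ (if m = 0 then (⊤ : Ideal R) else ⊥)
        by_cases hn : n = 0
        · subst hn
          obtain rfl : m = 0 := Nat.le_zero.mp hmn
          exact le_rfl
        · rw [if_neg hn]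
          exact bot_le
      mul_le := by
        intro m n
        show (if m = 0 then (⊤ : Ideal R) else ⊥) * (if n = 0 then (⊤ : Ideal R) else ⊥) ≤
          (if m + n = 0 then (⊤ : Ideal R) else ⊥)
        by_cases hmn : m + n = 0
        · rw [if_pos hmn]
          exact le_top
        · by_cases hm : m = 0
          · have hn : n ≠ 0 := by omega
            rw [if_neg hn, Ideal.mul_bot]
            exact bot_le
          · rw [if_neg hm, Ideal.bot_mul]
            exact bot_le }
  have hI : ∀ n : ℕ, F.I n = if n = 0 then ⊤ else ⊥ := fun _ => rfl
  have hI1 : F.I 1 = ⊥ := by rw [hI]; exact if_neg one_ne_zero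
  refine ⟨F, by rw [hI1, h], ⟨1, Nat.one_pos, fun k => ?_⟩, ?_⟩
  · rw [hI1, mul_one]
    by_cases hk : k = 0
    · subst hk
      rw [pow_zero, Ideal.one_eq_top, hI]
      exact if_pos rfl
    · rw [hI, if_neg hk]
      exact (zero_pow hk).symm
  · intro N hN a ha 𝔐 h𝔐
    have hIN : F.I N = ⊥ := by rw [hI]; exact if_neg (Nat.pos_iff_ne_zero.mp hN)
    rw [hIN, Ideal.mem_bot] at ha
    subst ha
    have h0 : homogBar F N 0 (by rw [hIN]; exact Ideal.zero_mem _) = 0 := by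
      change Ideal.Quotient.mk _ (homog F N 0 _) = 0
      have : homog F N (0 : R) (by rw [hIN]; exact Ideal.zero_mem _) = 0 := by
        apply Subtype.ext
        change LaurentPolynomial.C (0 : R) * LaurentPolynomial.T (N : ℤ) = 0
        rw [map_zero, zero_mul]
      rw [this, map_zero]
    haveI : Subsingleton (Localization.Away (homogBar F N 0 (by rw [hIN]; exact Ideal.zero_mem _))) :=
      IsLocalization.subsingleton (M := Submonoid.powers (homogBar F N 0 _)) (by rw [h0]; exact Submonoid.mem_powers _)
    exact (h𝔐.ne_top (𝔐.eq_top_iff_one.mpr (by rw [Subsingleton.elim (1 : Localization.Away _) 0]; exact 𝔐.zero_mem))).elim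

/-! ## §1 The branch `d = 1`: discrete valuation rings, via COR D1 -/

/-- The generic point `(0)` of the spectrum of a local domain which is not a field is not the closed point `𝔪`. [folklore] -/
theorem genericPoint_ne_closedPoint_of_ne_bot (A : Type) [CommRing A] [IsDomain A] [IsLocalRing A]
    (hm : maximalIdeal A ≠ ⊥) : genericPoint (Spec (.of A)) ≠ IsLocalRing.closedPoint A := by
  intro h
  apply hm
  have h2 := congrArg PrimeSpectrum.asIdeal h
  rw [genericPoint_eq_bot_of_affine] at h2
  exact h2.symm

/-- **GDD for a normal local domain of dimension one, from COR D1.**  A Noetherian integrally closed local domain `A` with `dim A = 1` is a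
discrete valuation ring (Dedekind and local), hence regular; the closed point `{𝔪}` of `Spec A` is a strict normal crossings divisor
(`𝔪 = (ϖ)` in `𝒪_{Spec A, 𝔪} ≅ A`), its reduced ideal sheaf is an effective Cartier divisor
(`IsStrictNormalCrossingsDivisor.isEffectiveCartier_vanishingIdeal`), so the identity of `Spec A` is the blowing up along it (`IsBlowup.id`)
and COR D1 `hD` (by text: idea-1's `gdd_of_sncBlowupModel`) gives `GDD p A`.  [OURS · L1 W4.5a helper; KNOWN bookkeeping modulo `hD`] -/
theorem gdd_of_dim_one_of
    (hD : ∀ (p : ℕ) [Fact p.Prime] (A : Type) [CommRing A] [IsDomain A] [IsNoetherianRing A] [IsLocalRing A] [IsIntegrallyClosed A]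
        [CharP A p] (X' : Scheme.{0}) (π : X' ⟶ Spec (.of A)) (𝓛 : (Spec (.of A)).IdealSheafData),
        𝓛 ≠ ⊥ → (𝓛.support : Set (Spec (.of A))) ⊆ {IsLocalRing.closedPoint A} → IsBlowup π 𝓛 → Scheme.IsRegular X' →
        IsStrictNormalCrossingsDivisor X' (π ⁻¹' {IsLocalRing.closedPoint A}) → GDD p A)
    (p : ℕ) [Fact p.Prime] (A : Type) [CommRing A] [IsDomain A] [IsNoetherianRing A] [IsLocalRing A] [IsIntegrallyClosed A]
    [CharP A p] (hdim : ringKrullDim A = (1 : ℕ)) : GDD p A := by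
  classical
  set X : Scheme.{0} := Spec (.of A) with hXdef
  -- `A` is a Dedekind domain, hence a regular ring
  haveI : Ring.KrullDimLE 1 A := Ring.krullDimLE_iff.mpr hdim.le
  haveI : Ring.DimensionLEOne A := ⟨fun hP hPp => hPp.isMaximal_of_ne_bot hP⟩
  haveI : IsDedekindRing A := (isDedekindRing_iff A (FractionRing A)).mpr
    ⟨inferInstance, inferInstance, fun hx => (isIntegrallyClosed_iff (FractionRing A)).mp inferInstance hx⟩
  have hm0 : maximalIdeal A ≠ ⊥ := fun h => by
    have h0 := ringKrullDim_eq_zero_of_isField (IsLocalRing.isField_iff_maximalIdeal_eq.mpr h)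
    rw [hdim] at h0
    exact absurd h0 (by norm_num)
  have hXreg : Scheme.IsRegular X := by
    intro x
    have hx : x ∈ Scheme.regularLocus X := by
      rw [regularLocus_Spec_eq]
      exact (inferInstance : IsRegularLocalRing (Localization.AtPrime x.asIdeal))
    exact (Scheme.mem_regularLocus x).mp hx
  -- the closed point and its stalk, a DVR
  have hc : IsClosed ({IsLocalRing.closedPoint A} : Set X) :=
    (PrimeSpectrum.isClosed_singleton_iff_isMaximal _).mpr (IsLocalRing.maximalIdeal.isMaximal A)
  letI : Algebra A (X.presheaf.stalk (IsLocalRing.closedPoint A)) :=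
    (StructureSheaf.toStalk A (IsLocalRing.closedPoint A)).hom.toAlgebra
  haveI hloc : IsLocalization.AtPrime (X.presheaf.stalk (IsLocalRing.closedPoint A)) (maximalIdeal A) :=
    StructureSheaf.IsLocalization.to_stalk A (IsLocalRing.closedPoint A)
  haveI : IsDiscreteValuationRing (X.presheaf.stalk (IsLocalRing.closedPoint A)) :=
    IsLocalization.AtPrime.isDiscreteValuationRing_of_dedekind_domain A hm0 _
  obtain ⟨ϖ, hϖ⟩ := IsDiscreteValuationRing.exists_irreducible (X.presheaf.stalk (IsLocalRing.closedPoint A))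
  have hmax : maximalIdeal (X.presheaf.stalk (IsLocalRing.closedPoint A)) = Ideal.span {ϖ} :=
    (IsDiscreteValuationRing.irreducible_iff_uniformizer ϖ).mp hϖ
  have hdimc : ringKrullDim (X.presheaf.stalk (IsLocalRing.closedPoint A)) = ((1 + 0 : ℕ) : WithBot ℕ∞) := by
    rw [IsLocalization.AtPrime.ringKrullDim_eq_height (maximalIdeal A) (X.presheaf.stalk (IsLocalRing.closedPoint A)),
      IsLocalRing.maximalIdeal_height_eq_ringKrullDim, hdim]
  -- `{𝔪}` is a strict normal crossings divisor on `Spec A`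
  have hsnc : IsStrictNormalCrossingsDivisor X ({IsLocalRing.closedPoint A} : Set X) := by
    rw [isStrictNormalCrossingsDivisor_iff_stalkIdeal]
    refine ⟨hc, fun q hq => ?_⟩
    have hq' : q = IsLocalRing.closedPoint A := hq
    subst hq'
    refine ⟨hXreg _, 1, 0, fun _ => ϖ, fun i => i.elim0, le_rfl, hdimc, ?_, ?_⟩
    · rw [hmax, Set.range_const, Set.range_eq_empty, Set.union_empty]
    · rw [stalkIdeal_vanishingIdeal_eq_maximalIdeal_of_closure_eq rfl, hmax, Fin.prod_const, pow_one]
  -- its ideal sheaf: effective Cartier, supported at `𝔪`, non-zero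
  set T : Closeds X := ⟨{IsLocalRing.closedPoint A}, hc⟩ with hTdef
  have hcart : IsEffectiveCartier (vanishingIdeal T) := hsnc.isEffectiveCartier_vanishingIdeal
  have hsupp : ((vanishingIdeal T).support : Set X) = {IsLocalRing.closedPoint A} :=
    Scheme.IdealSheafData.coe_support_vanishingIdeal T
  have hne : vanishingIdeal T ≠ ⊥ := by
    intro h0
    have hmem : genericPoint X ∈ ((vanishingIdeal T).support : Set X) := by
      rw [h0, support_bot]; trivial
    rw [hsupp] at hmem
    exact genericPoint_ne_closedPoint_of_ne_bot A hm0 hmem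
  have hpre : (𝟙 X : X ⟶ X) ⁻¹' ({IsLocalRing.closedPoint A} : Set X) = {IsLocalRing.closedPoint A} := by
    ext x
    exact Iff.rfl
  exact hD p A X (𝟙 X) _ hne hsupp.le (IsBlowup.id hcart) hXreg (hpre ▸ hsnc)

/-! ## §2 The dispatcher -/

/-- **ThmD-≤3 (dispatcher; plan-1's named target `gdd_of_isolated_dim_le_three`, binders of idea-1's ThmDSig r16 minus `hL`).**  Let `S` be a
finite-type domain over a field `k` of characteristic `p`, `𝔭 ⊆ S` a maximal ideal with `S_𝔭` normal of dimension `≤ 3`, and assume `S_𝔮`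
regular for every prime `𝔮 < 𝔭` (the singularity at `𝔭` is isolated).  Then `GDD p S_𝔭` — given BY TEXT COR D1 `hD` (idea-1's
`gdd_of_sncBlowupModel`) and the surface case `h2` (idea-1's `gdd_of_normalSurfacePoint`, itself modulo `Lipman1978SequenceFinite`), and BY NAME
`CossartPiltant2019General`, `Stacks081R`, `CossartPiltant2019Principalization`, `CossartJannsenSaito2020EmbeddedSequenceB`.
Dispatch on `dim S_𝔭`: `0` (junk: `S_𝔭` is a field) `gdd_of_radical_bot`; `1` `gdd_of_dim_one_of hD`; `2` `h2`; `3` (C) STEP 1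
`GDDOfIsolatedDimThree.gdd_of_isolatedSingularity_dimThree_of` after transporting quasi-excellence (07QW/07QU) and isolatedness
(`(S_𝔭)_𝔔 ≅ S_{𝔔 ∩ S}`) to `A = S_𝔭`.  [OURS · L1 W4.5a helper toward ThmD-≤3; KNOWN dispatch modulo `hD`, `h2`] -/
theorem gdd_of_isolated_dim_le_three_of
    (hD : ∀ (p : ℕ) [Fact p.Prime] (A : Type) [CommRing A] [IsDomain A] [IsNoetherianRing A] [IsLocalRing A] [IsIntegrallyClosed A]
        [CharP A p] (X' : Scheme.{0}) (π : X' ⟶ Spec (.of A)) (𝓛 : (Spec (.of A)).IdealSheafData),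
        𝓛 ≠ ⊥ → (𝓛.support : Set (Spec (.of A))) ⊆ {IsLocalRing.closedPoint A} → IsBlowup π 𝓛 → Scheme.IsRegular X' →
        IsStrictNormalCrossingsDivisor X' (π ⁻¹' {IsLocalRing.closedPoint A}) → GDD p A)
    (h2 : ∀ (p : ℕ) [Fact p.Prime] (k : Type) [Field k] [CharP k p]
        (S : Type) [CommRing S] [IsDomain S] [Algebra k S] [Algebra.FiniteType k S]
        (𝔭 : Ideal S) [𝔭.IsMaximal] [IsIntegrallyClosed (Localization.AtPrime 𝔭)],
        ringKrullDim (Localization.AtPrime 𝔭) = (2 : ℕ) → GDD p (Localization.AtPrime 𝔭))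
    (hG : CossartPiltant2019General.{0}) (h081R : Stacks081R.{0}) (hP : CossartPiltant2019Principalization.{0})
    (hCJS : CossartJannsenSaito2020EmbeddedSequenceB.{0}) (p : ℕ) [Fact p.Prime] (k : Type) [Field k] [CharP k p]
    (S : Type) [CommRing S] [IsDomain S] [Algebra k S] [Algebra.FiniteType k S]
    (𝔭 : Ideal S) [𝔭.IsMaximal] [IsIntegrallyClosed (Localization.AtPrime 𝔭)]
    (hdim : ringKrullDim (Localization.AtPrime 𝔭) ≤ 3)
    (hiso : ∀ (𝔮 : Ideal S) [𝔮.IsPrime], 𝔮 < 𝔭 → IsRegularLocalRing (Localization.AtPrime 𝔮)) :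
    GDD p (Localization.AtPrime 𝔭) := by
  classical
  haveI : IsNoetherianRing S := Algebra.FiniteType.isNoetherianRing k S
  haveI : IsNoetherianRing (Localization.AtPrime 𝔭) := IsLocalization.isNoetherianRing 𝔭.primeCompl _ inferInstance
  haveI : CharP (Localization.AtPrime 𝔭) p :=
    charP_of_injective_algebraMap (algebraMap k (Localization.AtPrime 𝔭)).injective p
  obtain ⟨n, hn⟩ := exists_nat_cast_eq_ringKrullDim (R := Localization.AtPrime 𝔭)
  have hn3 : n ≤ 3 := by
    rw [hn] at hdim
    exact_mod_cast hdim
  rcases Nat.lt_or_ge n 1 with h0 | h1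
  · -- `n = 0`: `S_𝔭` is a field
    obtain rfl : n = 0 := by omega
    haveI : Ring.KrullDimLE 0 (Localization.AtPrime 𝔭) := Ring.krullDimLE_iff.mpr hn.le
    have hbot : (⊥ : Ideal (Localization.AtPrime 𝔭)).IsMaximal := Ring.krullDimLE_zero_iff.mp inferInstance ⊥ Ideal.isPrime_bot
    refine gdd_of_radical_bot p _ ?_
    rw [← IsLocalRing.eq_maximalIdeal hbot]
    exact nilradical_eq_zero _
  rcases Nat.lt_or_ge n 2 with h1' | h2'
  · -- `n = 1`
    obtain rfl : n = 1 := by omega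
    exact gdd_of_dim_one_of hD p _ hn
  rcases Nat.lt_or_ge n 3 with h2'' | h3
  · -- `n = 2`
    obtain rfl : n = 2 := by omega
    exact h2 p k S 𝔭 hn
  · -- `n = 3`: transport to (C) STEP 1
    obtain rfl : n = 3 := le_antisymm hn3 h3
    have hS : IsQuasiExcellentRing S := isQuasiExcellentRing_of_finiteType_field k S
    have hA : IsQuasiExcellentRing (Localization.AtPrime 𝔭) := isQuasiExcellentRing_of_isLocalization 𝔭.primeCompl hS
    have hqe : Scheme.IsQuasiExcellent (Spec (.of (Localization.AtPrime 𝔭))) :=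
      Scheme.isQuasiExcellent_of_locallyOfFiniteType_of_isQuasiExcellentRing Stacks07QU_holds hA (𝟙 _)
    refine GDDOfIsolatedDimThree.gdd_of_isolatedSingularity_dimThree_of hD hG h081R hP hCJS p (Localization.AtPrime 𝔭) hqe hn
      fun 𝔔 _ h𝔔 => ?_
    -- `𝔔 ≠ 𝔪` contracts to `𝔮 < 𝔭`, and `(S_𝔭)_𝔔 ≅ S_𝔮`
    have hle : 𝔔.comap (algebraMap S (Localization.AtPrime 𝔭)) ≤ 𝔭 := by
      have h1 : 𝔔 ≤ maximalIdeal (Localization.AtPrime 𝔭) := IsLocalRing.le_maximalIdeal (Ideal.IsPrime.ne_top inferInstance)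
      have h2 := Ideal.comap_mono (f := algebraMap S (Localization.AtPrime 𝔭)) h1
      have h3 : (maximalIdeal (Localization.AtPrime 𝔭)).comap (algebraMap S (Localization.AtPrime 𝔭)) = 𝔭 :=
        Localization.AtPrime.under_maximalIdeal
      rwa [h3] at h2
    have hne : 𝔔.comap (algebraMap S (Localization.AtPrime 𝔭)) ≠ 𝔭 := fun h =>
      h𝔔 (Localization.AtPrime.eq_maximalIdeal_iff_under_eq.mp h)
    have hreg := hiso (𝔔.comap (algebraMap S (Localization.AtPrime 𝔭))) (lt_of_le_of_ne hle hne)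
    exact IsRegularLocalRing.of_ringEquiv
      (IsLocalization.localizationLocalizationAtPrimeIsoLocalization 𝔭.primeCompl 𝔔).toRingEquiv

end Summit.ResolutionOfSingularities.ResolutionOfSingularities.Theorems.FInjectiveMacaulayfication.GDDOfIsolatedDimLeThree

end
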